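import Mathlib.LinearAlgebra.Determinant
import Mathlib.LinearAlgebra.Matrix.Determinant.Basic
import Mathlib.LinearAlgebra.Dimension.Free
import Mathlib.NumberTheory.Padics.PadicIntegers
import Mathlib.GroupTheory.Index
import Mathlib.GroupTheory.OrderOfElement
import Mathlib.GroupTheory.GroupAction.Quotient
import Mathlib.RepresentationTheory.Basic
import Mathlib.Tactic.NoncommRing
import Mathlib.Tactic.Module
import HarnessLib

/-!
# Scalars `≡ 1 (mod p)` in a `p`-adic representation whose residual image has order prime to `p`
# and scalar commutant (Lombardo–Tronto 2022, §3.1 "group-theoretic criteria", kernel form)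

Topic `NumberTheory/GaloisRepresentations`; THEOREMS ONLY (no definition, no named fact).

D. Lombardo, S. Tronto, *Some uniform bounds for elliptic curves over `ℚ`*, Pacific J. Math. 320
(2022) 133–175 [LombardoTronto2022], §3.1 Prop. 3.4 / Cor. 3.7 (held text: S. Tronto, PhD thesis,
Leiden 2022, Ch. 2, `lit galaxy read pdf:1196786020`, pp. 60–63): for a closed subgroup
`G ≤ GL₂(ℤ_ℓ)`, `ℓ > 2`, with `det G = ℤ_ℓˣ`, `ℓ ∤ #G_ℓ` and `G_ℓ` containing suitable elements
(the normaliser of a Cartan subgroup suffices, Cor. 3.7), `G ⊇ 1 + ℓℤ_ℓ` (the scalars congruent to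
`1`). Their proof is an induction on the level: a lift `C = (1+ℓ)·Id + ℓⁿ B ∈ G_{ℓ^{n+1}}` of the
scalar `(1+ℓ)·Id ∈ G_{ℓⁿ}` is AVERAGED over conjugates (`C τ̃ C τ̃⁻¹`, `∏ ũ^k C' ũ^{-k}`) until the
first-order term `ℓⁿ(∑ conjugates of B)` is a scalar, the determinant (Lemma 3.3: `det(H_n) = 1 + ℓⁿℤ_ℓ`
when `ℓ ∤ #G_ℓ`) guaranteeing that the scalar found has the right valuation.

This file proves the same mechanism ONCE, coordinate-free and for an ARBITRARY residual image of
order prime to `p` with scalar commutant (which covers all three shapes of Prop. 3.4 / Cor. 3.7 and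
the exceptional images): let `T` be a free `ℤ_p`-module of rank `2`, `ρ : Γ → End_{ℤ_p}(T)` a
representation of a group `Γ`, `K ⊴ Γ` a normal subgroup of finite index `m` prime to `p` whose
elements act trivially modulo `p` (think `K = ker ρ̄`, `m = #ρ̄(Γ)`), and suppose every endomorphism
of `T` commuting with `ρ(Γ)` modulo `p` is a scalar modulo `p` (Schur for `ρ̄`). Then for every
`σ₀ ∈ Γ` and every `n`, SOME element of `Γ` acts on `T` as the scalar `det ρ(σ₀)^{m^{n+1}}` modulo
`p^{n+1}` (`exists_apply_eq_det_pow_smul_one_add`). The averaging is over a full set of coset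
representatives of `K` (`∏_{s ∈ Γ/K} s τ s⁻¹`): the first-order term `∑_s ρ(s) W ρ(s)⁻¹` of the
product is `ρ(Γ)`-invariant modulo `p` (the cosets are permuted; `K` moves `W` only modulo `p`), hence
a scalar modulo `p` by the commutant hypothesis, so the average of an element `≡ λ·1 (mod pⁿ⁺¹)` is
`≡ λ'·1 (mod pⁿ⁺²)`; squaring and `det ρ(τ) = det ρ(σ₀)^{mᵏ}` (determinants are multiplicative and
conjugation-invariant) identify the scalar exactly: `ρ(τ²) ≡ det ρ(τ)·1`. Starting point:
`τ₁ = σ₀^m ∈ K`. No parity hypothesis on `p` is needed here (for `p = 2` the hypotheses are never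
met by an elliptic curve).

Consumer: `Literature/NumberTheory/EllipticCurves/MastellaZerman2026/HasPadicScalarImageOfIrreducibleProofs`
(the Mastella–Zerman 2026 image hypothesis "`ρ_{E,p^∞}(G_ℚ) ∋ 1 + pℤ_p`" for `E/ℚ` with `E[p]`
irreducible and `ρ̄_{E,p}` not surjective — Lombardo–Tronto Thm. 3.16 (`ℓ = 5, 7`, case 3) and
Prop. 3.12 (`ℓ = 3`), in kernel form), cell `bsd-print-x9` seat ty2.

## References

* [LombardoTronto2022] D. Lombardo, S. Tronto, Pacific J. Math. 320 (2022), §3.1: Lemma 3.3,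
  Prop. 3.4, Remark 3.5, Cor. 3.7; §3.3 Prop. 3.12; §3.4 Thm. 3.16.
* [Serre1972] J.-P. Serre, Invent. Math. 15 (1972), §2.4 Prop. 15 (residual images of order prime
  to `p`).
-/

set_option autoImplicit false

noncomputable section

open scoped Classical

namespace Literature.NumberTheory.GaloisRepresentations

namespace PrimeToPScalars

variable {p : ℕ} [Fact p.Prime] {T : Type*} [AddCommGroup T] [Module ℤ_[p] T]
  {Γ : Type*} [Group Γ]

/-! ### §1. Elementary algebra in `End_{ℤ_p}(T)` -/

/-- Conjugating `λ·(1 + c·W)` by `ρ(s)`: `ρ(s) (λ(1 + cW)) ρ(s⁻¹) = λ(1 + c · ρ(s) W ρ(s⁻¹))`.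
[folklore] -/
private theorem conj_smul_one_add (ρ : Representation ℤ_[p] Γ T) (s : Γ) (lam c : ℤ_[p])
    (W : Module.End ℤ_[p] T) :
    ρ s * (lam • (1 + c • W)) * ρ s⁻¹ = lam • (1 + c • (ρ s * W * ρ s⁻¹)) := by
  have h1 : ρ s * ρ s⁻¹ = 1 := by rw [← map_mul, mul_inv_cancel, map_one]
  rw [mul_smul_comm, smul_mul_assoc, mul_add, mul_one, add_mul, h1, mul_smul_comm, smul_mul_assoc]

/-- First-order expansion of a product of elements `1 + c·Wᵢ`:
`∏ (1 + c Wᵢ) = 1 + c ∑ Wᵢ + c² R`. [folklore] -/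
private theorem exists_prod_one_add_smul_eq (c : ℤ_[p]) :
    ∀ l : List (Module.End ℤ_[p] T), ∃ R : Module.End ℤ_[p] T,
      (l.map fun W => 1 + c • W).prod = 1 + c • l.sum + (c * c) • R
  | [] => ⟨0, by simp⟩
  | W :: l => by
    obtain ⟨R, hR⟩ := exists_prod_one_add_smul_eq c l
    refine ⟨R + W * l.sum + c • (W * R), ?_⟩
    rw [List.map_cons, List.prod_cons, List.sum_cons, hR]
    simp only [mul_add, add_mul, one_mul, mul_one, smul_add, mul_smul_comm, smul_mul_assoc,
      smul_smul]
    module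

/-- Scalars pull out of a list product: `∏ (λ · xᵢ) = λ^{#l} · ∏ xᵢ`. [folklore] -/
private theorem prod_map_smul {ι : Type*} (lam : ℤ_[p]) (f : ι → Module.End ℤ_[p] T) :
    ∀ l : List ι, (l.map fun i => lam • f i).prod = lam ^ l.length • (l.map f).prod
  | [] => by simp
  | i :: l => by
    rw [List.map_cons, List.prod_cons, List.map_cons, List.prod_cons, List.length_cons,
      prod_map_smul lam f l, smul_mul_assoc, mul_smul_comm, smul_smul, pow_succ, mul_comm]

/-- A constant list product is a power. [folklore] -/
private theorem prod_map_const {ι M : Type*} [Monoid M] (d : M) :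
    ∀ l : List ι, (l.map fun _ => d).prod = d ^ l.length
  | [] => by simp
  | i :: l => by rw [List.map_cons, List.prod_cons, List.length_cons, prod_map_const d l, pow_succ']

/-- An element of `ℤ_p` congruent to `1` modulo `p` is a unit. [folklore] -/
private theorem isUnit_of_dvd_sub_one {a : ℤ_[p]} (ha : (p : ℤ_[p]) ∣ a - 1) : IsUnit a := by
  have hmem : 1 - a ∈ nonunits ℤ_[p] := by
    rw [← IsLocalRing.mem_maximalIdeal, PadicInt.maximalIdeal_eq_span_p, Ideal.mem_span_singleton]
    have : (1 : ℤ_[p]) - a = -(a - 1) := by ring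
    rw [this]
    exact (dvd_neg).mpr ha
  have h := IsLocalRing.isUnit_one_sub_self_of_mem_nonunits (1 - a) hmem
  rwa [sub_sub_cancel] at h

/-! ### §2. Determinants modulo `p^k` on a free rank-two module -/

section Det

variable [Module.Free ℤ_[p] T] [Module.Finite ℤ_[p] T]

/-- `det(λ·(1 + c·W)) = λ² (1 + c d)` for some `d`, on a free `ℤ_p`-module of rank `2` (expand the
`2 × 2` determinant in a basis). [folklore] -/
private theorem exists_det_smul_one_add_eq (hT : Module.finrank ℤ_[p] T = 2) (lam c : ℤ_[p])
    (W : Module.End ℤ_[p] T) :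
    ∃ d : ℤ_[p], LinearMap.det (lam • (1 + c • W)) = lam ^ 2 * (1 + c * d) := by
  let b := Module.finBasisOfFinrankEq ℤ_[p] T hT
  set M := LinearMap.toMatrix b b W with hM
  refine ⟨M 0 0 + M 1 1 + c * (M 0 0 * M 1 1 - M 0 1 * M 1 0), ?_⟩
  rw [← LinearMap.det_toMatrix b, LinearEquiv.map_smul, Matrix.det_smul, Fintype.card_fin,
    map_add, LinearEquiv.map_smul, ← hM,
    show LinearMap.toMatrix b b (1 : Module.End ℤ_[p] T) = 1 from LinearMap.toMatrix_one b,
    Matrix.det_fin_two]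
  simp only [Matrix.add_apply, Matrix.one_apply_eq, Matrix.smul_apply, smul_eq_mul,
    Matrix.one_apply_ne (show (0 : Fin 2) ≠ 1 by decide),
    Matrix.one_apply_ne (show (1 : Fin 2) ≠ 0 by decide)]
  ring

end Det

/-! ### §3. The averaging step -/

section Average

variable (ρ : Representation ℤ_[p] Γ T) (K : Subgroup Γ)

/-- Conjugation by an element of `K` moves an endomorphism only modulo `p`, when `K` acts trivially
modulo `p`: `ρ(k) W ρ(k⁻¹) = W + p D`. [folklore] -/
private theorem exists_conj_eq_add_of_mem (hK : ∀ k ∈ K, ∃ U : Module.End ℤ_[p] T, ρ k = 1 + (p : ℤ_[p]) • U)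
    {k : Γ} (hk : k ∈ K) (W : Module.End ℤ_[p] T) :
    ∃ D : Module.End ℤ_[p] T, ρ k * W * ρ k⁻¹ = W + (p : ℤ_[p]) • D := by
  obtain ⟨U, hU⟩ := hK k hk
  obtain ⟨U', hU'⟩ := hK k⁻¹ (inv_mem hk)
  refine ⟨W * U' + U * W + (p : ℤ_[p]) • (U * W * U'), ?_⟩
  rw [hU, hU']
  simp only [mul_add, add_mul, one_mul, mul_one, smul_add, mul_smul_comm, smul_mul_assoc,
    smul_smul]
  module

/-- **The first-order term of the coset average is `ρ(Γ)`-invariant modulo `p`.** For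
`Σ = ∑_{q ∈ Γ/K} ρ(q̃) W ρ(q̃⁻¹)` (any section `q ↦ q̃`): `ρ(g) Σ ρ(g⁻¹) = Σ + p D` — left
multiplication by `g` permutes the cosets, and changing a representative inside its coset moves the
term only modulo `p` (`exists_conj_eq_add_of_mem`). [cite: LombardoTronto2022, Prop. 3.4 (proof)] -/
theorem exists_conj_sum_eq_add [Fintype (Γ ⧸ K)]
    (hK : ∀ k ∈ K, ∃ U : Module.End ℤ_[p] T, ρ k = 1 + (p : ℤ_[p]) • U)
    (W : Module.End ℤ_[p] T) (g : Γ) :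
    ∃ D : Module.End ℤ_[p] T,
      ρ g * (∑ q : Γ ⧸ K, ρ q.out * W * ρ q.out⁻¹) * ρ g⁻¹ =
        (∑ q : Γ ⧸ K, ρ q.out * W * ρ q.out⁻¹) + (p : ℤ_[p]) • D := by
  -- each coset representative of `g • q` differs from `g * q.out` by an element of `K`
  have hmem : ∀ q : Γ ⧸ K, ((g • q).out)⁻¹ * (g * q.out) ∈ K := fun q => by
    rw [← QuotientGroup.eq, QuotientGroup.out_eq']
    change g • q = QuotientGroup.mk (g • q.out)
    rw [MulAction.Quotient.mk_smul_out]
  choose D hD using fun q : Γ ⧸ K => exists_conj_eq_add_of_mem ρ K hK (hmem q) W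
  refine ⟨∑ q : Γ ⧸ K, ρ (g • q).out * D q * ρ ((g • q).out)⁻¹, ?_⟩
  rw [Finset.mul_sum, Finset.sum_mul, Finset.smul_sum]
  -- reindex the right-hand sum along `q ↦ g • q`
  rw [show (∑ q : Γ ⧸ K, ρ q.out * W * ρ q.out⁻¹) =
      ∑ q : Γ ⧸ K, ρ (g • q).out * W * ρ ((g • q).out)⁻¹ from
    (Fintype.sum_equiv (MulAction.toPerm g) _ _ fun q => rfl).symm, ← Finset.sum_add_distrib]
  refine Finset.sum_congr rfl fun q _ => ?_
  -- `g * q.out = s' * k` with `s' = (g • q).out`, `k ∈ K`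
  set s' := (g • q).out with hs'
  set k := s'⁻¹ * (g * q.out) with hk
  have hgq : g * q.out = s' * k := by rw [hk, mul_inv_cancel_left]
  have hinv : (q.out)⁻¹ * g⁻¹ = k⁻¹ * s'⁻¹ := by
    rw [← mul_inv_rev, ← mul_inv_rev, hgq]
  calc ρ g * (ρ q.out * W * ρ q.out⁻¹) * ρ g⁻¹
      = ρ (g * q.out) * W * ρ (q.out⁻¹ * g⁻¹) := by simp only [map_mul, mul_assoc]
    _ = ρ s' * (ρ k * W * ρ k⁻¹) * ρ s'⁻¹ := by rw [hgq, hinv]; simp only [map_mul, mul_assoc]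
    _ = ρ s' * W * ρ s'⁻¹ + (p : ℤ_[p]) • (ρ s' * D q * ρ s'⁻¹) := by
        rw [hD q, mul_add, add_mul, mul_smul_comm, smul_mul_assoc]

/-- **The averaging step.** If `τ ∈ Γ` acts as `λ·(1 + p^{n+1} W)` with `λ` a unit, then the coset
average `τ' = ∏_{q ∈ Γ/K} q̃ τ q̃⁻¹` acts as `λ'·(1 + p^{n+2} W')` with `λ'` a unit, and
`det ρ(τ') = (det ρ(τ))^m`, `m = [Γ : K]` — provided `K` acts trivially modulo `p` and the
`ρ(Γ)`-commutant is scalar modulo `p`. (Lombardo–Tronto's induction step, Prop. 3.4, in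
coordinate-free form: the first-order term of the average is invariant modulo `p`, hence scalar.)
[cite: LombardoTronto2022, Prop. 3.4 (proof)] -/
theorem step [Module.Free ℤ_[p] T] [Module.Finite ℤ_[p] T] [Fintype (Γ ⧸ K)]
    (hK : ∀ k ∈ K, ∃ U : Module.End ℤ_[p] T, ρ k = 1 + (p : ℤ_[p]) • U)
    (hC : ∀ S : Module.End ℤ_[p] T,
      (∀ g : Γ, ∃ D : Module.End ℤ_[p] T, ρ g * S * ρ g⁻¹ = S + (p : ℤ_[p]) • D) →
        ∃ (z : ℤ_[p]) (U : Module.End ℤ_[p] T), S = z • 1 + (p : ℤ_[p]) • U)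
    (n : ℕ) {τ : Γ} {lam : ℤ_[p]} (hlam : IsUnit lam) {W : Module.End ℤ_[p] T}
    (hτ : ρ τ = lam • (1 + ((p : ℤ_[p]) ^ (n + 1)) • W)) :
    ∃ (τ' : Γ) (lam' : ℤ_[p]) (W' : Module.End ℤ_[p] T), IsUnit lam' ∧
      ρ τ' = lam' • (1 + ((p : ℤ_[p]) ^ (n + 2)) • W') ∧
      LinearMap.det (ρ τ') = LinearMap.det (ρ τ) ^ Fintype.card (Γ ⧸ K) := by
  set reps : List Γ := (Finset.univ : Finset (Γ ⧸ K)).toList.map Quotient.out with hreps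
  have hlen : reps.length = Fintype.card (Γ ⧸ K) := by
    rw [hreps, List.length_map, Finset.length_toList, Finset.card_univ]
    rfl
  -- the first-order term of the average is the coset sum
  have hsum : (reps.map fun s => ρ s * W * ρ s⁻¹).sum = ∑ q : Γ ⧸ K, ρ q.out * W * ρ q.out⁻¹ := by
    rw [hreps, List.map_map]
    exact Finset.sum_map_toList _ _
  clear_value reps
  set c : ℤ_[p] := (p : ℤ_[p]) ^ (n + 1) with hc
  refine ⟨(reps.map fun s => s * τ * s⁻¹).prod, ?_⟩
  -- `ρ` of the average, factor by factor
  have hρ : ρ (reps.map fun s => s * τ * s⁻¹).prod =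
      lam ^ reps.length • (reps.map fun s => 1 + c • (ρ s * W * ρ s⁻¹)).prod := by
    rw [map_list_prod, List.map_map, ← prod_map_smul lam]
    congr 1
    refine List.map_congr_left fun s _ => ?_
    simp only [Function.comp_apply, map_mul, hτ]
    exact conj_smul_one_add ρ s lam c W
  obtain ⟨R, hR⟩ := exists_prod_one_add_smul_eq c (reps.map fun s => ρ s * W * ρ s⁻¹)
  simp only [List.map_map, Function.comp_def] at hR
  -- … invariant modulo `p`, hence scalar modulo `p`
  obtain ⟨z, U, hzU⟩ := hC _ (exists_conj_sum_eq_add ρ K hK W)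
  rw [← hsum] at hzU
  -- the new unit and the new error term
  have hu : IsUnit (1 + c * z) := by
    refine isUnit_of_dvd_sub_one ?_
    rw [add_sub_cancel_left, hc]
    exact ⟨(p : ℤ_[p]) ^ n * z, by ring⟩
  obtain ⟨u, hu'⟩ := hu
  refine ⟨lam ^ reps.length * u, (u⁻¹ : ℤ_[p]ˣ) • (U + ((p : ℤ_[p]) ^ n) • R), ?_, ?_, ?_⟩
  · exact (hlam.pow _).mul u.isUnit
  · rw [hρ, hR, hzU, ← smul_smul (lam ^ reps.length : ℤ_[p])]
    congr 1
    rw [smul_add (u : ℤ_[p]), smul_comm (u : ℤ_[p]) ((p : ℤ_[p]) ^ (n + 2)), Units.smul_def,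
      smul_smul (u : ℤ_[p]), Units.mul_inv, one_smul, hu', hc]
    module
  · rw [map_list_prod, map_list_prod, List.map_map, List.map_map]
    have : ((⇑LinearMap.det ∘ ⇑ρ) ∘ fun s => s * τ * s⁻¹) = fun _ : Γ => LinearMap.det (ρ τ) := by
      funext s
      simp only [Function.comp_apply, map_mul]
      rw [mul_comm (LinearMap.det (ρ s)), mul_assoc, ← map_mul LinearMap.det, ← map_mul ρ,
        mul_inv_cancel, map_one, map_one, mul_one]
    rw [this, prod_map_const, hlen]

/-- **Iterating the averaging step from `τ₁ = σ₀^m`.** For every `n`, some `τ ∈ Γ` acts as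
`λ·(1 + p^{n+1} W)` with `λ` a unit and `det ρ(τ) = det ρ(σ₀)^{m^{n+1}}`.
[cite: LombardoTronto2022, Prop. 3.4 (proof, induction on n)] -/
theorem exists_apply_eq_smul_one_add [Module.Free ℤ_[p] T] [Module.Finite ℤ_[p] T] [K.Normal]
    [Fintype (Γ ⧸ K)]
    (hK : ∀ k ∈ K, ∃ U : Module.End ℤ_[p] T, ρ k = 1 + (p : ℤ_[p]) • U)
    (hC : ∀ S : Module.End ℤ_[p] T,
      (∀ g : Γ, ∃ D : Module.End ℤ_[p] T, ρ g * S * ρ g⁻¹ = S + (p : ℤ_[p]) • D) →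
        ∃ (z : ℤ_[p]) (U : Module.End ℤ_[p] T), S = z • 1 + (p : ℤ_[p]) • U)
    (σ₀ : Γ) (n : ℕ) :
    ∃ (τ : Γ) (lam : ℤ_[p]) (W : Module.End ℤ_[p] T), IsUnit lam ∧
      ρ τ = lam • (1 + ((p : ℤ_[p]) ^ (n + 1)) • W) ∧
      LinearMap.det (ρ τ) = LinearMap.det (ρ σ₀) ^ Fintype.card (Γ ⧸ K) ^ (n + 1) := by
  induction n with
  | zero =>
    have hmem : σ₀ ^ Fintype.card (Γ ⧸ K) ∈ K := by
      rw [← Nat.card_eq_fintype_card, ← Subgroup.index_eq_card]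
      exact Subgroup.pow_index_mem K σ₀
    obtain ⟨U, hU⟩ := hK _ hmem
    refine ⟨σ₀ ^ Fintype.card (Γ ⧸ K), 1, U, isUnit_one, ?_, ?_⟩
    · rw [hU, one_smul, zero_add, pow_one]
    · rw [map_pow, map_pow, zero_add, pow_one]
  | succ n ih =>
    obtain ⟨τ, lam, W, hlam, hτ, hdet⟩ := ih
    obtain ⟨τ', lam', W', hlam', hτ', hdet'⟩ := step ρ K hK hC n hlam hτ
    refine ⟨τ', lam', W', hlam', hτ', ?_⟩
    rw [hdet', hdet, ← pow_mul, ← pow_succ]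

/-- **Main theorem (Lombardo–Tronto 2022 §3.1 in kernel form).** Let `T` be a free `ℤ_p`-module of
rank `2` with a representation `ρ` of `Γ`, `K ⊴ Γ` of finite index `m` prime to `p` acting trivially
modulo `p`, and assume the `ρ(Γ)`-commutant of `End(T)` is scalar modulo `p`. Then for every `σ₀ ∈ Γ`
and every `n`, some `σ ∈ Γ` acts on `T` as the SCALAR `det ρ(σ₀)^{m^{n+1}}` modulo `p^{n+1}`:
`ρ(σ) = det ρ(σ₀)^{m^{n+1}} · 1 + p^{n+1} V`. (With `det ρ` onto `1 + pℤ_p` and `p ∤ m` this gives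
every scalar `≡ 1 (mod p)` modulo every `p^{n+1}`, i.e. `1 + pℤ_p ⊆ ρ(Γ)` for a closed image —
Prop. 3.4's conclusion; the consumer file does this for `T_pE`.)
[cite: LombardoTronto2022, Prop. 3.4 and Cor. 3.7] -/
theorem exists_apply_eq_det_pow_smul_one_add [Module.Free ℤ_[p] T] [Module.Finite ℤ_[p] T]
    (hT : Module.finrank ℤ_[p] T = 2) (ρ : Representation ℤ_[p] Γ T) (K : Subgroup Γ) [K.Normal]
    (hindex : ¬ p ∣ K.index)
    (hK : ∀ k ∈ K, ∃ U : Module.End ℤ_[p] T, ρ k = 1 + (p : ℤ_[p]) • U)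
    (hC : ∀ S : Module.End ℤ_[p] T,
      (∀ g : Γ, ∃ D : Module.End ℤ_[p] T, ρ g * S * ρ g⁻¹ = S + (p : ℤ_[p]) • D) →
        ∃ (z : ℤ_[p]) (U : Module.End ℤ_[p] T), S = z • 1 + (p : ℤ_[p]) • U)
    (σ₀ : Γ) (n : ℕ) :
    ∃ (σ : Γ) (V : Module.End ℤ_[p] T),
      ρ σ = (LinearMap.det (ρ σ₀) ^ K.index ^ (n + 1)) • 1 + ((p : ℤ_[p]) ^ (n + 1)) • V := by
  haveI : K.FiniteIndex := ⟨fun h => hindex (h ▸ dvd_zero p)⟩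
  haveI : Finite (Γ ⧸ K) := Subgroup.finite_quotient_of_finiteIndex
  letI : Fintype (Γ ⧸ K) := Fintype.ofFinite _
  have hidx : K.index = Fintype.card (Γ ⧸ K) := by
    rw [Subgroup.index_eq_card, Nat.card_eq_fintype_card]
  obtain ⟨τ, lam, W, -, hτ, hdet⟩ := exists_apply_eq_smul_one_add ρ K hK hC σ₀ n
  set c : ℤ_[p] := (p : ℤ_[p]) ^ (n + 1) with hc
  set A : ℤ_[p] := LinearMap.det (ρ σ₀) ^ K.index ^ (n + 1) with hA
  -- `λ² = det ρ(τ) - c e = A - c e`, and `ρ(τ²) = λ² (1 + cW)²`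
  obtain ⟨d, hd⟩ := exists_det_smul_one_add_eq hT lam c W
  obtain ⟨e, he⟩ : ∃ e : ℤ_[p], lam ^ 2 = A - c * e := by
    refine ⟨lam ^ 2 * d, ?_⟩
    have hA' : LinearMap.det (ρ τ) = A := by rw [hdet, hA, hidx]
    rw [← hA', hτ, hd]
    ring
  have hsq : lam • (1 + c • W) * (lam • (1 + c • W)) =
      (lam ^ 2) • (1 + c • ((2 : ℤ_[p]) • W + c • (W * W))) := by
    rw [smul_mul_smul_comm, ← pow_two]
    congr 1
    simp only [mul_add, add_mul, one_mul, mul_one, smul_add, mul_smul_comm, smul_mul_assoc,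
      smul_smul, two_smul]
    module
  refine ⟨τ * τ, A • ((2 : ℤ_[p]) • W + c • (W * W)) -
    e • (1 + c • ((2 : ℤ_[p]) • W + c • (W * W))), ?_⟩
  rw [map_mul, hτ, hsq, he]
  module

end Average

end PrimeToPScalars

end Literature.NumberTheory.GaloisRepresentations

end
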